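import Mathlib
import HarnessLib.Audit
import Summits.PneNP.PneNP.Theorems.PstarTipsChain

/-!
# The tips-chain and hanging bounds are false as absolute bounds: the shared-literal star (ROUND-24, memo §14.6 — refutation)

FRONTIER range-avoidance ladder, rung F-N3, ROUND 24 (cell `pnp-ideate`, planner memo `r24/CORE-BOUND-NOTES.md` §14.6 PLAN B; restricted-model proof complexity —
nothing here bears on `P` versus `NP`).

The family `f_i = (a, b_i; u_i, v_i)`, `i < k`, sharing ONE AND variable `a` (pure, typed, simple overlaps, `(r, 3/2)`-expanding for every `r`:
`#bdry X ≥ 3·#X`), with the hun-clean pair `A = (Σ_i (u_i + v_i) = 1, no monomials)`, `w = (a = 0)` and `y = 0`, is a `TerminalNC` core of size `k`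
(with `a = 0` every output reads `u_i + v_i = 0`, so `A ≡ 0 ≠ 1`; deleting `f_j` frees the tip `u_j`), it is its own maximal peelable sub-family (no
chords, privates-unread vacuous), and its XOR core is empty.  Hence

* `not_hangingBound : ∀ h, ¬ HangingBound h` and `not_tipsChainBound : ∀ c, ¬ TipsChainBound c`.

So PLAN B's covers need more than an absolute bound on stand-alone minimal cores (one pinned SHARED literal kills any number of hanging monomials,
and a non-closed family pays for the sharing with its tips); `PstarTipsChain.card_xcore_le_five` (the XOR core of each cover's minimal core has at most
five outputs) is what survives.
-/

set_option linter.dupNamespace false -- `Summit.PneNP.PneNP.…`: summit = sub-problem name (D-0017 single-conjunct layout)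

open Finset Literature.Computability.Complexity
open Summit.PneNP.PneNP.Theorems.PstarFibrePolys (bit bit_injective)
open Summit.PneNP.PneNP.Theorems.PstarTyped (Typed)
open Summit.PneNP.PneNP.Theorems.PstarSALevel (varSet bdry BoundaryExpanding SimpleOverlap)
open Summit.PneNP.PneNP.Theorems.PstarGapPeeling (eval_pure)
open Summit.PneNP.PneNP.Theorems.PstarCentreFree (vars_mem_varSet)
open Summit.PneNP.PneNP.Theorems.PstarGapOneAll (gval)
open Summit.PneNP.PneNP.Theorems.PstarGConstraint (bit_gval)
open Summit.PneNP.PneNP.Theorems.PstarCoreBound (XorClosed)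
open Summit.PneNP.PneNP.Theorems.PstarChordBridgeCotree (Peelable)
open Summit.PneNP.PneNP.Theorems.PstarChordBridgeTools (xpdeg)
open Summit.PneNP.PneNP.Theorems.PstarGateUnit (mem_bdry_of_unique)
open Summit.PneNP.PneNP.Theorems.PstarUnion (SatPair)
open Summit.PneNP.PneNP.Theorems.PstarUnionCovers (TerminalNC TipsChainBound)
open Summit.PneNP.PneNP.Theorems.PstarTipsPeel (xcore mem_xcore)
open Summit.PneNP.PneNP.Theorems.PstarTipsChain (HangingBound)

namespace Summit.PneNP.PneNP.Theorems.PstarTipsChainRefutation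

/-! ## The shared-literal star -/

variable (k : ℕ)

/-- the tip `u_i` -/
def uV (i : Fin k) : Fin (3 * k + 1) := ⟨3 * i.val, by omega⟩
/-- the tip `v_i` -/
def vV (i : Fin k) : Fin (3 * k + 1) := ⟨3 * i.val + 1, by omega⟩
/-- the private AND variable `b_i` -/
def bV (i : Fin k) : Fin (3 * k + 1) := ⟨3 * i.val + 2, by omega⟩
/-- the shared AND variable `a` -/
def aV : Fin (3 * k + 1) := ⟨3 * k, by omega⟩

/-- **The shared-literal star**: `k` outputs `f_i = (a, b_i; u_i, v_i)`. -/
def star : LocalMap 4 (3 * k + 1) k where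
  vars i := ![uV k i, vV k i, aV k, bV k i]
  table _ := xorAndPred

/-- Slot values. -/
theorem vars_eq (i : Fin k) : (star k).vars i 0 = uV k i ∧ (star k).vars i 1 = vV k i ∧ (star k).vars i 2 = aV k ∧ (star k).vars i 3 = bV k i :=
  ⟨rfl, rfl, rfl, rfl⟩

/-- Every slot value is one of the four. -/
theorem vars_cases (i : Fin k) (s : Fin 4) :
    (star k).vars i s = uV k i ∨ (star k).vars i s = vV k i ∨ (star k).vars i s = aV k ∨ (star k).vars i s = bV k i := by
  fin_cases s
  · exact Or.inl rfl
  · exact Or.inr (Or.inl rfl)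
  · exact Or.inr (Or.inr (Or.inl rfl))
  · exact Or.inr (Or.inr (Or.inr rfl))

/-- Membership in a variable set. -/
theorem mem_varSet_iff (i : Fin k) (w : Fin (3 * k + 1)) :
    w ∈ varSet (star k) i ↔ w = uV k i ∨ w = vV k i ∨ w = aV k ∨ w = bV k i := by
  constructor
  · intro hw
    unfold PstarSALevel.varSet at hw
    obtain ⟨s, -, rfl⟩ := mem_image.1 hw
    exact vars_cases k i s
  · rintro (rfl | rfl | rfl | rfl)
    · exact (vars_eq k i).1 ▸ vars_mem_varSet _ i 0
    · exact (vars_eq k i).2.1 ▸ vars_mem_varSet _ i 1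
    · exact (vars_eq k i).2.2.1 ▸ vars_mem_varSet _ i 2
    · exact (vars_eq k i).2.2.2 ▸ vars_mem_varSet _ i 3

/-- The tips and privates identify their output. -/
theorem eq_of_mem_varSet {i j : Fin k} {w : Fin (3 * k + 1)} (hw : w = uV k i ∨ w = vV k i ∨ w = bV k i) (hj : w ∈ varSet (star k) j) :
    j = i := by
  rw [mem_varSet_iff] at hj
  have hi := i.2; have hj' := j.2
  apply Fin.ext
  rcases hw with rfl | rfl | rfl <;> rcases hj with h | h | h | h <;>
    simp only [uV, vV, bV, aV, Fin.ext_iff] at h <;> omega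

/-- The four variables of an output are distinct. -/
theorem vars_distinct (i : Fin k) : uV k i ≠ vV k i ∧ uV k i ≠ aV k ∧ uV k i ≠ bV k i ∧ vV k i ≠ aV k ∧ vV k i ≠ bV k i ∧ aV k ≠ bV k i := by
  have hi := i.2
  simp only [uV, vV, aV, bV, ne_eq, Fin.ext_iff]
  omega

/-- The star is pure. -/
theorem star_pure : (star k).IsPure xorAndPred := by
  refine ⟨fun _ => rfl, fun i s t h => ?_⟩
  obtain ⟨h₁, h₂, h₃, h₄, h₅, h₆⟩ := vars_distinct k i
  fin_cases s <;> fin_cases t <;>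
    first | rfl | exact absurd h h₁ | exact absurd h h₁.symm | exact absurd h h₂ | exact absurd h h₂.symm | exact absurd h h₃ |
      exact absurd h h₃.symm | exact absurd h h₄ | exact absurd h h₄.symm | exact absurd h h₅ | exact absurd h h₅.symm | exact absurd h h₆ |
      exact absurd h h₆.symm

/-- The star is typed: XOR-slot variables (`≡ 0, 1 mod 3`, below `3k`) are not AND-slot variables (`3k` or `≡ 2 mod 3`). -/
theorem star_typed : Typed (star k) := by
  intro i j s t hs ht h
  have hi := i.2; have hj := j.2
  have hsv : ((star k).vars i s).val = 3 * i.val ∨ ((star k).vars i s).val = 3 * i.val + 1 := by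
    have : s = 0 ∨ s = 1 := by
      rcases s with ⟨_ | _ | q, hq⟩
      · exact Or.inl rfl
      · exact Or.inr rfl
      · exact absurd hs (by simp)
    rcases this with rfl | rfl
    · exact Or.inl rfl
    · exact Or.inr rfl
  have htv : ((star k).vars j t).val = 3 * k ∨ ((star k).vars j t).val = 3 * j.val + 2 := by
    have : t = 2 ∨ t = 3 := by
      rcases t with ⟨_ | _ | _ | _ | q, hq⟩
      · exact absurd ht (by simp)
      · exact absurd ht (by simp)
      · exact Or.inl rfl
      · exact Or.inr rfl
      · omega
    rcases this with rfl | rfl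
    · exact Or.inl rfl
    · exact Or.inr rfl
  have hv := congrArg Fin.val h
  omega

/-- The star has simple overlaps: two outputs share only `a`. -/
theorem star_simpleOverlap : SimpleOverlap (star k) := by
  classical
  intro i j hij
  have hsub : varSet (star k) i ∩ varSet (star k) j ⊆ {aV k} := by
    intro w hw
    rw [mem_inter, mem_varSet_iff, mem_varSet_iff] at hw
    rw [mem_singleton]
    obtain ⟨h1, h2⟩ := hw
    have hi := i.2; have hj := j.2
    have hne : i.val ≠ j.val := fun h => hij (Fin.ext h)
    rcases h1 with rfl | rfl | rfl | rfl
    · rcases h2 with h | h | h | h <;> simp only [uV, vV, aV, bV, Fin.ext_iff] at h ⊢ <;> omega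
    · rcases h2 with h | h | h | h <;> simp only [uV, vV, aV, bV, Fin.ext_iff] at h ⊢ <;> omega
    · rfl
    · rcases h2 with h | h | h | h <;> simp only [uV, vV, aV, bV, Fin.ext_iff] at h ⊢ <;> omega
  exact (card_le_card hsub).trans (card_singleton _).le

/-- The tips and the private of `f_i` are boundary variables of every family containing `f_i`. -/
theorem mem_bdry_star {X : Finset (Fin k)} {i : Fin k} (hi : i ∈ X) {w : Fin (3 * k + 1)} (hw : w = uV k i ∨ w = vV k i ∨ w = bV k i) :
    w ∈ bdry (star k) X := by
  refine mem_bdry_of_unique (star k) hi ((mem_varSet_iff k i w).2 ?_) fun j _ hj => eq_of_mem_varSet k hw hj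
  rcases hw with h | h | h
  · exact Or.inl h
  · exact Or.inr (Or.inl h)
  · exact Or.inr (Or.inr (Or.inr h))

/-- **The star is `(r, 3/2)`-expanding for every `r`**: `#bdry X ≥ 3·#X`. -/
theorem star_expanding (r : ℕ) : BoundaryExpanding r (star k) := by
  classical
  intro X _
  -- the injection `X × 3 ↪ bdry X`
  let T : Fin k → Finset (Fin (3 * k + 1)) := fun i => {uV k i, vV k i, bV k i}
  have hT : ∀ i ∈ X, (T i).card = 3 := by
    intro i _
    obtain ⟨h₁, -, h₃, -, h₅, -⟩ := vars_distinct k i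
    rw [card_insert_of_notMem, card_insert_of_notMem, card_singleton]
    · rw [mem_singleton]; exact h₅
    · rw [mem_insert, mem_singleton, not_or]; exact ⟨h₁, h₃⟩
  have hdisj : ∀ i ∈ X, ∀ j ∈ X, i ≠ j → Disjoint (T i) (T j) := by
    intro i _ j _ hij
    rw [disjoint_left]
    intro w hwi hwj
    simp only [T, mem_insert, mem_singleton] at hwi hwj
    have hi := i.2; have hj := j.2
    have hne : i.val ≠ j.val := fun h => hij (Fin.ext h)
    rcases hwi with rfl | rfl | rfl <;> rcases hwj with h | h | h <;> simp only [uV, vV, bV, Fin.ext_iff] at h <;> omega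
  have hsub : X.biUnion T ⊆ bdry (star k) X := by
    intro w hw
    obtain ⟨i, hi, hwi⟩ := mem_biUnion.1 hw
    simp only [T, mem_insert, mem_singleton] at hwi
    exact mem_bdry_star k hi hwi
  have hcard : (X.biUnion T).card = 3 * X.card := by
    rw [card_biUnion hdisj, sum_congr rfl hT, sum_const, smul_eq_mul, mul_comm]
  have := card_le_card hsub
  omega

/-! ## The pair and the terminal conditions -/

/-- the reading constraint `Σ_i (u_i + v_i) = 1` -/
def pairA : Finset (Fin (3 * k + 1)) × Finset (Fin k) × Bool := (univ.biUnion fun i => {uV k i, vV k i}, ∅, true)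

/-- the pin `a = 0` -/
def pairW : Finset (Fin (3 * k + 1)) × Finset (Fin k) × Bool := ({aV k}, ∅, false)

/-- The value of `A`: `Σ_i (x_{u_i} + x_{v_i})`. -/
theorem bit_gval_pairA (x : Fin (3 * k + 1) → Bool) :
    bit (gval (star k) (pairA k).1 (pairA k).2.1 x) = ∑ i : Fin k, (bit (x (uV k i)) + bit (x (vV k i))) := by
  classical
  unfold pairA
  rw [bit_gval, sum_empty, add_zero, sum_biUnion]
  · refine sum_congr rfl fun i _ => ?_
    rw [sum_pair (vars_distinct k i).1]
  · intro i _ j _ hij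
    rw [Function.onFun, disjoint_left]
    intro w hwi hwj
    simp only [mem_insert, mem_singleton] at hwi hwj
    have hi := i.2; have hj := j.2
    have hne : i.val ≠ j.val := fun h => hij (Fin.ext h)
    rcases hwi with rfl | rfl <;> rcases hwj with h | h <;> simp only [uV, vV, Fin.ext_iff] at h <;> omega

/-- The value of `w`: `x_a`. -/
theorem gval_pairW (x : Fin (3 * k + 1) → Bool) : gval (star k) (pairW k).1 (pairW k).2.1 x = x (aV k) := by
  apply bit_injective
  unfold pairW
  rw [bit_gval, sum_singleton, sum_empty, add_zero]

/-- The equation of `f_i` in bits. -/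
theorem bit_eval_star (x : Fin (3 * k + 1) → Bool) (i : Fin k) :
    bit ((star k).eval x i) = bit (x (uV k i)) + bit (x (vV k i)) + bit (x (aV k)) * bit (x (bV k i)) := by
  rw [PstarPDT.bit_eval (star_pure k) x i]
  rfl

/-- **The whole star is infeasible for the pair** (`y = 0`): with `a = 0` every output reads `u_i + v_i = 0`, so `A ≡ 0 ≠ 1`. -/
theorem not_satPair_univ : ¬ SatPair (star k) (fun _ => false) univ (pairA k) (pairW k) := by
  rintro ⟨x, hx, hA, hw⟩
  have hw' : x (aV k) = false := by rw [gval_pairW] at hw; exact hw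
  have hA' := congrArg bit hA
  rw [bit_gval_pairA] at hA'
  have hzero : ∑ i : Fin k, (bit (x (uV k i)) + bit (x (vV k i))) = 0 := by
    refine sum_eq_zero fun i _ => ?_
    have h := congrArg bit (hx i (mem_univ i))
    rw [bit_eval_star, hw'] at h
    simpa [bit] using h
  rw [hzero] at hA'
  exact absurd hA' (by simp [pairA, bit])

/-- **Deleting any output makes the pair feasible**: switch on the freed tip `u_j`. -/
theorem satPair_erase (j : Fin k) : SatPair (star k) (fun _ => false) (univ.erase j) (pairA k) (pairW k) := by
  classical
  refine ⟨fun w => decide (w = uV k j), fun i hi => ?_, ?_, ?_⟩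
  · have hij : i ≠ j := ne_of_mem_erase hi
    obtain ⟨-, h₂, -, h₄, -, h₆⟩ := vars_distinct k i
    apply bit_injective
    rw [bit_eval_star]
    have hu : decide (uV k i = uV k j) = false := decide_eq_false fun h => hij (by
      have := congrArg Fin.val h; simp only [uV] at this; exact Fin.ext (by omega))
    have hv : decide (vV k i = uV k j) = false := decide_eq_false fun h => by
      have := congrArg Fin.val h; simp only [uV, vV] at this; omega
    have ha : decide (aV k = uV k j) = false := decide_eq_false fun h => by
      have := congrArg Fin.val h; have hj := j.2; simp only [uV, aV] at this; omega
    rw [hu, hv, ha]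
    simp [bit]
  · apply bit_injective
    rw [bit_gval_pairA, Finset.sum_eq_single j]
    · have hv : decide (vV k j = uV k j) = false := decide_eq_false fun h => by
        have := congrArg Fin.val h; simp only [uV, vV] at this; omega
      simp [hv, bit, pairA]
    · intro i _ hij
      have hu : decide (uV k i = uV k j) = false := decide_eq_false fun h => hij (by
        have := congrArg Fin.val h; simp only [uV] at this; exact Fin.ext (by omega))
      have hv : decide (vV k i = uV k j) = false := decide_eq_false fun h => by
        have := congrArg Fin.val h; simp only [uV, vV] at this; omega
      rw [hu, hv]; simp [bit]
    · intro h; exact absurd (mem_univ j) h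
  · rw [gval_pairW]
    have hj := j.2
    exact decide_eq_false fun h => by have := congrArg Fin.val h; simp only [uV, aV] at this; omega

/-- **The star is `TerminalNC`** for the pair, with `r = k + 1` (`k ≥ 1`). -/
theorem terminalNC_star (hk : 1 ≤ k) : TerminalNC (star k) (k + 1) (fun _ => false) univ (pairA k) (pairW k) := by
  refine ⟨⟨⟨0, by omega⟩, mem_univ _⟩, by rw [card_univ, Fintype.card_fin]; omega, ?_, ?_, ?_, not_satPair_univ k,
    fun j _ => satPair_erase k j⟩
  · show Disjoint univ (∅ : Finset (Fin k)); exact disjoint_empty_right _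
  · show Disjoint univ (∅ : Finset (Fin k)); exact disjoint_empty_right _
  · show (univ ∪ (∅ : Finset (Fin k)) ∪ ∅).card ≤ k + 1
    rw [union_empty, union_empty, card_univ, Fintype.card_fin]; omega

/-- The star is leaf-peelable (every output has a private tip). -/
theorem peelable_star : Peelable (star k) univ := by
  classical
  intro S _ hS
  obtain ⟨i, hi⟩ := hS
  refine ⟨uV k i, ?_⟩
  unfold PstarChordBridgeTools.xpdeg PstarXorElimination.pdeg
  have h0 : (S.filter fun j => (star k).vars j 0 = uV k i) = {i} := by
    ext j
    simp only [mem_filter, mem_singleton]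
    constructor
    · rintro ⟨-, h⟩
      have := congrArg Fin.val h
      change 3 * j.val = 3 * i.val at this
      exact Fin.ext (by omega)
    · rintro rfl; exact ⟨hi, rfl⟩
  have h1 : (S.filter fun j => (star k).vars j 1 = uV k i) = ∅ := by
    refine filter_eq_empty_iff.2 fun j _ h => ?_
    have := congrArg Fin.val h
    change 3 * j.val + 1 = 3 * i.val at this
    omega
  rw [h0, h1, card_singleton, card_empty]

/-- The XOR core of the star is empty (every output has a tip). -/
theorem xcore_star : xcore (star k) univ = ∅ := by
  refine eq_empty_iff_forall_notMem.2 fun f hf => ?_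
  obtain ⟨S, -, hX, hfS⟩ := (mem_xcore (star k)).1 hf
  exact hX f hfS 0 (by decide) (mem_bdry_star k hfS (Or.inl rfl))

/-! ## The refutations -/

/-- **The hanging bound is false for every `h`.** -/
theorem not_hangingBound (h : ℕ) : ¬ HangingBound h := by
  intro hH
  have hk : 1 ≤ h + 1 := by omega
  have := hH (3 * (h + 1) + 1) (h + 1) (h + 1 + 1) (star (h + 1)) (star_pure _) (star_typed _) (star_simpleOverlap _) (star_expanding _ _)
    (fun _ => false) univ (pairA (h + 1)) (pairW (h + 1)) (terminalNC_star (h + 1) hk) univ (Subset.refl _) (peelable_star _)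
    (fun F' hF hF' _ => Subset.antisymm hF' hF) (fun e he => absurd he (by simp))
    (fun g hg => absurd hg (by simp [pairA, pairW]))
  rw [xcore_star, sdiff_empty, card_univ, Fintype.card_fin] at this
  omega

/-- **The tips-chain bound is false for every `c`.** -/
theorem not_tipsChainBound (c : ℕ) : ¬ TipsChainBound c := by
  intro hC
  have hk : 1 ≤ c + 1 := by omega
  have := hC (3 * (c + 1) + 1) (c + 1) (c + 1 + 1) (star (c + 1)) (star_pure _) (star_typed _) (star_simpleOverlap _) (star_expanding _ _)
    (fun _ => false) univ (pairA (c + 1)) (pairW (c + 1)) (terminalNC_star (c + 1) hk) univ (Subset.refl _) (peelable_star _)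
    (fun F' hF hF' _ => Subset.antisymm hF' hF) (fun e he => absurd he (by simp))
    (fun g hg => absurd hg (by simp [pairA, pairW]))
  rw [card_univ, Fintype.card_fin] at this
  omega

end Summit.PneNP.PneNP.Theorems.PstarTipsChainRefutation
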